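import Literature.NumberTheory.DiophantineGeometry.GenEllDeCriticalLocusFamily
import Literature.NumberTheory.DiophantineGeometry.GenEllDeCriticalLocusReduction
import HarnessLib

/-!
# Good-prime reduction for the critical locus of the family `t_c` on `D_e`
# (GenEllTwo, support piece W5c for the family of S6's ruling #6)

Companion of `GenEllDeCriticalLocusFamily.lean` and `c`-parametric twin of
`GenEllDeCriticalLocusReduction.lean` (same setting and sources: S. Mochizuki, *Arithmetic elliptic
curves in general position*, Math. J. Okayama Univ. 52 (2010), Thm. 2.1 proof p. 12
[cite: MochizukiGenEll2010]; abc-iut-S6 `GENELLTWO-P1ROUTE.md` §3 (d) and OWNER RULING #6 +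
AMENDMENT: «W5 must be stated for the family `t_c = 1/r + c·r^{k+1}/s`»). For an arbitrary valuation
`v` of a field `K` (e.g. the `w`-adic valuation of a number field at a finite place `w`) with
`v(2) = v(2k+1) = v(c) = 1` ("good prime for the member `c` of the family"), and a `v`-integral point
`P = (x, r)` of `D_e : r^{2k+1} = x(1 − x)` with `v(N_c(P)) < 1` ("`w` divides `N_c(P)`",
`N_c = −s³ + c·α(r) = r²s³·dt_c/dr`):

* `units_of_NvalC_lt` — `r` and `s = 1 − 2x` are `v`-units (the prime does not see the poles of
  `t_c`);
* `map_RpolyC_lt_of_NvalC_lt`, `exists_rootC_near` — `v(R_c(r)) < 1`, and if `R_c = c²α² − β³`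
  splits in `K` then `r` is congruent to a root `θ` of `R_c`;
* `exists_critPointC_near` — **`P` is congruent modulo the prime to the ramification point
  `Q_θ = (x_θ, θ)` of `t_c`** (`v(r − θ) < 1`, `v(x − x_θ) < 1`), whose coordinates `θ`, `β(θ)`,
  `1 − 2x_θ` are `v`-units;
* `exists_critValueC_near` — consequently **`v(t_c(P) − t_c(Q_θ)) < 1`** for
  `t_c = ((1 − 2x) + c·r^{k+2})/(r·(1 − 2x))` (the expression of `GenEllDeFibresFamily.fibreC_iff_t`):
  a good prime dividing `N_c(P)` is a prime at which `t_c(P)` meets the critical-value set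
  `A_c = t_c(R_{t_c})` — the converse input ("(G2)", `hconv` of `De.good_place_dichotomy` /
  `De.ord_placewise`) of the summation in §3 (d) of the architecture note: the ramification credit
  `ord⁺_w N_c(P)` is only spent at primes where `t_c(P)` meets `B ⊇ A_c`;
* `exists_mem_valuation_tC_sub_lt_one` — the same packaged with an arbitrary set `B ∋ t_c(Q_θ)`
  for all roots `θ` ("critical values ⊆ B" ⇒ `∃ b ∈ B, v(t_c(P) − b) < 1`);
* `one_lt_map_NvalC_of_one_lt` (appended) — off the integral chart (`v(r) > 1`) one has
  `v(N_c(P)) > 1`: no ramification credit; hence `exists_mem_valuation_tC_sub_lt_one'`, the `hconv`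
  supplier with NO integrality hypothesis on `P`.

Pure valuation-theoretic algebra (ultrametric inequalities), reusing the integrality / congruence
lemmas of the `c = 1` file by name; no named facts. Nothing here bears on the disputed parts of the
abc-iut corpus.
-/

noncomputable section

open Polynomial

namespace Literature.NumberTheory.DiophantineGeometry.GenEll

namespace DeCrit

section Valued

/-! ## Good-prime reduction for `N_c`: a prime dividing `N_c(P)` sees `P` congruent to a
ramification point of `t_c` -/

variable {K : Type*} [Field K] {Γ₀ : Type*} [LinearOrderedCommGroupWithZero Γ₀] (v : Valuation K Γ₀)

/-- In a linearly ordered commutative group with zero, `a ≤ 1` and `b < 1` give `a·b < 1`.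
[folklore] -/
private theorem mul_lt_one_of_le_of_ltC {a b : Γ₀} (ha : a ≤ 1) (hb : b < 1) : a * b < 1 :=
  Right.mul_lt_one_of_le_of_lt ha hb

/-- Natural numbers have valuation `≤ 1`. [folklore] -/
private theorem map_natCast_le_oneC (n : ℕ) : v (n : K) ≤ 1 := by
  induction n with
  | zero => simp
  | succ n ih =>
    push_cast
    exact (v.map_add_le ih (le_of_eq v.map_one))

/-- Products preserve congruences modulo the maximal ideal: `a ≡ a'`, `b ≡ b'` (valuation of the
difference `< 1`), `a`, `b'` integral ⇒ `ab ≡ a'b'`. [folklore] -/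
private theorem map_mul_sub_mul_ltC {a a' b b' : K} (ha : v a ≤ 1) (hb' : v b' ≤ 1)
    (haa : v (a - a') < 1) (hbb : v (b - b') < 1) : v (a * b - a' * b') < 1 := by
  have : a * b - a' * b' = a * (b - b') + (a - a') * b' := by ring
  rw [this]
  refine v.map_add_lt ?_ ?_
  · rw [Valuation.map_mul]
    exact mul_lt_one_of_le_of_ltC ha hbb
  · rw [Valuation.map_mul, mul_comm]
    exact mul_lt_one_of_le_of_ltC hb' haa

/-- Powers preserve congruences modulo the maximal ideal. [folklore] -/
private theorem map_pow_sub_pow_ltC {a a' : K} (ha : v a ≤ 1) (ha' : v a' ≤ 1) (haa : v (a - a') < 1)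
    (n : ℕ) : v (a ^ n - a' ^ n) < 1 := by
  induction n with
  | zero => simp
  | succ n ih =>
    rw [pow_succ, pow_succ]
    exact map_mul_sub_mul_ltC v (by rw [Valuation.map_pow]; exact pow_le_one' ha n) ha' ih haa

/-- If `v(c) = 1` then `c ≠ 0`. [folklore] -/
private theorem ne_zero_of_map_eq_oneC {c : K} (hcv : v c = 1) : c ≠ 0 := by
  intro h0; rw [h0, Valuation.map_zero] at hcv; exact zero_ne_one hcv

/-- **A prime dividing `N_c(P)` does not see the poles of `t_c`**: if `P = (x, r) ∈ D_e` is
`v`-integral, `v(2) = v(2k+1) = v(c) = 1` and `v(N_c(P)) < 1`, then `r` and `s = 1 − 2x` are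
`v`-units. [cite: MochizukiGenEll2010, Thm 2.1 proof p.12] -/
theorem units_of_NvalC_lt (k : ℕ) (h2 : v 2 = 1) (he : v ((2 * k + 1 : ℕ) : K) = 1) {c : K}
    (hcv : v c = 1) {x r : K} (h : r ^ (2 * k + 1) = x * (1 - x)) (hr : v r ≤ 1)
    (hN : v (NvalC k c (x, r)) < 1) : v r = 1 ∧ v (1 - 2 * x) = 1 := by
  have hs := map_s_le_one v k h hr
  have hβs : beta k r = (1 - 2 * x) ^ 2 := beta_eq_sq_of_mem k h
  rw [NvalC_eq_of_mem k c h] at hN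
  set s := 1 - 2 * x with hs_def
  have hα1 := map_alpha_le_one v k hr
  have hβ1 := map_beta_le_one v k hr
  -- (a) `r` is a unit
  have hr1 : v r = 1 := by
    by_contra hr1
    have hr' : v r < 1 := lt_of_le_of_ne hr hr1
    -- `c·α(r)` and `β(r) − 1` are divisible by `r`
    have hα : v (c * alpha k r) < 1 := by
      have e : c * alpha k r = r * (c * (((k : K) + 1) * r ^ (k + 1) - 2 * r ^ (3 * k + 2))) := by
        simp only [alpha]; ring
      rw [e, Valuation.map_mul, mul_comm]
      refine mul_lt_one_of_le_of_ltC ?_ hr'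
      rw [Valuation.map_mul, hcv, one_mul]
      refine v.map_sub_le ?_ ?_
      · rw [Valuation.map_mul, Valuation.map_pow]
        refine mul_le_one' ?_ (pow_le_one' hr _)
        have := map_natCast_le_oneC v (k + 1)
        push_cast at this
        exact this
      · rw [Valuation.map_mul, Valuation.map_pow]
        exact mul_le_one' (by exact_mod_cast map_natCast_le_oneC v 2) (pow_le_one' hr _)
    have hβ : v (beta k r - 1) < 1 := by
      have e : beta k r - 1 = r * (-(4 * r ^ (2 * k))) := by simp only [beta]; ring
      rw [e, Valuation.map_mul, mul_comm]
      refine mul_lt_one_of_le_of_ltC ?_ hr'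
      rw [Valuation.map_neg, Valuation.map_mul, Valuation.map_pow]
      exact mul_le_one' (by exact_mod_cast map_natCast_le_oneC v 4) (pow_le_one' hr _)
    -- hence `s·β ≡ 0`, `s ≡ 0`, contradicting `s² = β ≡ 1`
    have hsβ : v (s * beta k r) < 1 := by
      have e : s * beta k r = c * alpha k r - (-(s * beta k r) + c * alpha k r) := by ring
      rw [e]
      exact v.map_sub_lt hα hN
    have hs0 : v s < 1 := by
      have e : s = s * beta k r - s * (beta k r - 1) := by ring
      rw [e]
      refine v.map_sub_lt hsβ ?_
      rw [Valuation.map_mul]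
      exact mul_lt_one_of_le_of_ltC hs hβ
    have : v (1 : K) < 1 := by
      have e : (1 : K) = s * s - (beta k r - 1) := by rw [hβs]; ring
      rw [e]
      refine v.map_sub_lt ?_ hβ
      rw [Valuation.map_mul]
      exact mul_lt_one_of_le_of_ltC hs hs0
    rw [Valuation.map_one] at this
    exact lt_irrefl _ this
  refine ⟨hr1, ?_⟩
  -- (b) `s` is a unit
  by_contra hs1
  have hs' : v s < 1 := lt_of_le_of_ne hs hs1
  have hβ : v (beta k r) < 1 := by
    rw [hβs, Valuation.map_pow]
    exact mul_lt_one_of_le_of_ltC hs hs' |> (by rw [pow_two]; exact ·)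
  have hcα : v (c * alpha k r) < 1 := by
    have e : c * alpha k r = (-(s * beta k r) + c * alpha k r) + s * beta k r := by ring
    rw [e]
    refine v.map_add_lt hN ?_
    rw [Valuation.map_mul]
    exact mul_lt_one_of_le_of_ltC hs hβ
  have hα : v (alpha k r) < 1 := by
    rw [Valuation.map_mul, hcv, one_mul] at hcα; exact hcα
  -- `(2k+1)·r^{k+2} = 2α − r^{k+2}·β` would then be a non-unit
  have hid : ((2 * k + 1 : ℕ) : K) * r ^ (k + 2) = 2 * alpha k r - r ^ (k + 2) * beta k r := by
    simp only [alpha, beta]; push_cast; ring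
  have hlt : v (((2 * k + 1 : ℕ) : K) * r ^ (k + 2)) < 1 := by
    rw [hid]
    refine v.map_sub_lt ?_ ?_
    · rw [Valuation.map_mul, h2, one_mul]; exact hα
    · rw [Valuation.map_mul, Valuation.map_pow, hr1, one_pow, one_mul]; exact hβ
  rw [Valuation.map_mul, Valuation.map_pow, he, hr1, one_pow, one_mul] at hlt
  exact lt_irrefl _ hlt

/-- If `v(N_c(P)) < 1` for a `v`-integral point `P = (x, r) ∈ D_e` and `v(c) ≤ 1`, then
`v(R_c(r)) < 1` (`R_c = (cα − sβ)(cα + sβ)` on the curve). [cite: MochizukiGenEll2010, Thm 2.1 proof p.12] -/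
theorem map_RpolyC_lt_of_NvalC_lt (k : ℕ) {c : K} (hcv : v c ≤ 1) {x r : K}
    (h : r ^ (2 * k + 1) = x * (1 - x)) (hr : v r ≤ 1) (hN : v (NvalC k c (x, r)) < 1) :
    v ((RpolyC k c).eval r) < 1 := by
  have hs := map_s_le_one v k h hr
  have e : (RpolyC k c).eval r =
      (-((1 - 2 * x) * beta k r) + c * alpha k r) * (c * alpha k r + (1 - 2 * x) * beta k r) := by
    rw [eval_RpolyC]
    have hβs := beta_eq_sq_of_mem k h
    linear_combination (-(beta k r) ^ 2) * hβs
  rw [e, Valuation.map_mul, mul_comm]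
  rw [NvalC_eq_of_mem k c h] at hN
  refine mul_lt_one_of_le_of_ltC ?_ hN
  refine v.map_add_le ?_ ?_
  · rw [Valuation.map_mul]
    exact mul_le_one' hcv (map_alpha_le_one v k hr)
  · rw [Valuation.map_mul]
    exact mul_le_one' hs (map_beta_le_one v k hr)

/-- If `R_c` splits in `K` and `v(R_c(r)) < 1` with `v(2) = v(c) = 1` (so that the leading coefficient
`4c²` of `R_c` is a unit), then `r` is `v`-adically close to a root of `R_c`.
[cite: MochizukiGenEll2010, Thm 2.1 proof p.12] -/
theorem exists_rootC_near (k : ℕ) (h2 : v 2 = 1) {c : K} (hcv : v c = 1)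
    (hsplit : (RpolyC k c).Splits) {r : K} (hR : v ((RpolyC k c).eval r) < 1) :
    ∃ θ : K, (RpolyC k c).eval θ = 0 ∧ v (r - θ) < 1 := by
  classical
  have h4c : v (4 * c ^ 2 : K) = 1 := by
    have : (4 : K) = 2 * 2 := by norm_num
    rw [Valuation.map_mul, Valuation.map_pow, this, Valuation.map_mul, h2, hcv, one_mul, one_pow,
      one_mul]
  have h4c0 : (4 : K) * c ^ 2 ≠ 0 := ne_zero_of_map_eq_oneC v h4c
  set f := RpolyC k c with hf
  have hprod := hsplit.eq_prod_roots
  have hlc : f.leadingCoeff = 4 * c ^ 2 := leadingCoeff_RpolyC k h4c0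
  have hev : f.eval r = (4 * c ^ 2) * (f.roots.map (fun a => r - a)).prod := by
    conv_lhs => rw [hprod]
    rw [eval_mul, eval_C, hlc, eval_multiset_prod, Multiset.map_map]
    congr 1
    congr 1
    refine Multiset.map_congr rfl fun a _ => ?_
    simp
  rw [hev, Valuation.map_mul, h4c, one_mul, map_multiset_prod v, Multiset.map_map] at hR
  -- some factor has valuation `< 1`
  by_contra hcon
  simp only [not_exists, not_and, not_lt] at hcon
  have hge : 1 ≤ (Multiset.map (⇑v ∘ fun a => r - a) f.roots).prod := by
    refine Multiset.one_le_prod_of_one_le fun y hy => ?_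
    obtain ⟨a, ha, rfl⟩ := Multiset.mem_map.mp hy
    have haR : f.eval a = 0 := (mem_roots (RpolyC_ne_zero k c)).mp ha
    exact hcon a haR
  exact not_lt.mpr hge hR

/-- **Good-prime reduction for the family.** Let `v` be a valuation of the field `K` with
`v(2) = v(2k+1) = v(c) = 1` over which `R_c` splits, and `P = (x, r) ∈ D_e(K)` a `v`-integral point
with `v(N_c(P)) < 1`. Then `P` is `v`-adically congruent to a ramification point `Q_θ = (x_θ, θ)`
of `t_c` (`θ` a root of `R_c`): `v(r − θ) < 1`, `v(x − x_θ) < 1`, and `θ`, `β(θ)`, `1 − 2x_θ` are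
`v`-units. [cite: MochizukiGenEll2010, Thm 2.1 proof p.12] -/
theorem exists_critPointC_near (k : ℕ) (h2 : v 2 = 1) (he : v ((2 * k + 1 : ℕ) : K) = 1) {c : K}
    (hcv : v c = 1) (hsplit : (RpolyC k c).Splits) {x r : K}
    (h : r ^ (2 * k + 1) = x * (1 - x)) (hr : v r ≤ 1) (hN : v (NvalC k c (x, r)) < 1) :
    ∃ θ : K, (RpolyC k c).eval θ = 0 ∧ v (r - θ) < 1 ∧ v (x - critXC k c θ) < 1 ∧
      v θ = 1 ∧ v (beta k θ) = 1 ∧ v (1 - 2 * critXC k c θ) = 1 := by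
  obtain ⟨hr1, hs1⟩ := units_of_NvalC_lt v k h2 he hcv h hr hN
  obtain ⟨θ, hθR, hθ⟩ :=
    exists_rootC_near v k h2 hcv hsplit (map_RpolyC_lt_of_NvalC_lt v k hcv.le h hr hN)
  have h2K : (2 : K) ≠ 0 := ne_zero_of_map_eq_oneC v h2
  -- `θ` is a unit congruent to `r`
  have hθ1 : v θ = 1 := by
    have e : θ = r + -(r - θ) := by ring
    rw [e, Valuation.map_add_eq_of_lt_left, hr1]
    rw [Valuation.map_neg, hr1]; exact hθ
  have hθle : v θ ≤ 1 := hθ1.le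
  -- `β(θ) ≡ β(r) = s²` is a unit
  have hββ : v (beta k r - beta k θ) < 1 := map_beta_sub_beta_lt v k hr hθle hθ
  have hβs : beta k r = (1 - 2 * x) ^ 2 := beta_eq_sq_of_mem k h
  have hβr1 : v (beta k r) = 1 := by rw [hβs, Valuation.map_pow, hs1, one_pow]
  have hβθ1 : v (beta k θ) = 1 := by
    have e : beta k θ = beta k r + -(beta k r - beta k θ) := by ring
    rw [e, Valuation.map_add_eq_of_lt_left, hβr1]
    rw [Valuation.map_neg, hβr1]; exact hββ
  have hβθ : beta k θ ≠ 0 := ne_zero_of_map_eq_oneC v hβθ1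
  -- `s ≡ c·α(θ)/β(θ) = s_θ`
  set s := 1 - 2 * x with hs_def
  rw [NvalC_eq_of_mem k c h] at hN
  have hαα : v (alpha k r - alpha k θ) < 1 := map_alpha_sub_alpha_lt v k hr hθle hθ
  have hnum : v (beta k θ * s - c * alpha k θ) < 1 := by
    have e : beta k θ * s - c * alpha k θ =
        -(beta k r - beta k θ) * s +
          (-(-(s * beta k r) + c * alpha k r) + c * (alpha k r - alpha k θ)) := by
      ring
    rw [e]
    refine v.map_add_lt ?_ (v.map_add_lt (by rw [Valuation.map_neg]; exact hN) ?_)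
    · rw [Valuation.map_mul, Valuation.map_neg, mul_comm]
      exact mul_lt_one_of_le_of_ltC hs1.le hββ
    · rw [Valuation.map_mul, hcv, one_mul]; exact hαα
  have hsθ : v (s - critSC k c θ) < 1 := by
    have e : s - critSC k c θ = (beta k θ)⁻¹ * (beta k θ * s - c * alpha k θ) := by
      unfold critSC; field_simp
    rw [e, Valuation.map_mul, map_inv₀, hβθ1, inv_one, one_mul]
    exact hnum
  have hxθ : v (x - critXC k c θ) < 1 := by
    have e : x - critXC k c θ = -((2 : K)⁻¹ * (s - critSC k c θ)) := by
      unfold critXC; rw [hs_def]; field_simp; ring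
    rw [e, Valuation.map_neg, Valuation.map_mul, map_inv₀, h2, inv_one, one_mul]
    exact hsθ
  have hsθ1 : v (1 - 2 * critXC k c θ) = 1 := by
    rw [one_sub_two_mul_critXC k h2K]
    have e : critSC k c θ = s + -(s - critSC k c θ) := by ring
    rw [e, Valuation.map_add_eq_of_lt_left, hs1]
    rw [Valuation.map_neg, hs1]; exact hsθ
  exact ⟨θ, hθR, hθ, hxθ, hθ1, hβθ1, hsθ1⟩

/-- Quotients of congruent integral quantities with unit denominators are congruent: the form in
which the reduction is consumed for `t_c = (s + c·r^{k+2})/(r·s)` (numerator and denominator are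
polynomials in the coordinates, the denominator a unit at `P` and at `Q_θ`).  [folklore] -/
private theorem map_div_sub_div_ltC {a a' b b' : K} (ha : v a ≤ 1) (hb : v b = 1) (hb' : v b' = 1)
    (haa : v (a - a') < 1) (hbb : v (b - b') < 1) : v (a / b - a' / b') < 1 := by
  have hb0 : b ≠ 0 := ne_zero_of_map_eq_oneC v hb
  have hb0' : b' ≠ 0 := ne_zero_of_map_eq_oneC v hb'
  have e : a / b - a' / b' = (b * b')⁻¹ * (a * b' - a' * b) := by field_simp
  rw [e, Valuation.map_mul, map_inv₀, Valuation.map_mul, hb, hb', one_mul, inv_one, one_mul]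
  have hbb' : v (b' - b) < 1 := by rw [Valuation.map_sub_swap]; exact hbb
  exact map_mul_sub_mul_ltC v ha hb.le haa hbb'

/-- **The value `t_c(P)` reduces to the critical value `t_c(Q_θ)`**: under the hypotheses of
`exists_critPointC_near`, with `t_c = ((1 − 2x) + c·r^{k+2})/(r·(1 − 2x))` (the expression of
`De.fibreC_iff_t`), `v(t_c(P) − t_c(Q_θ)) < 1` for the ramification point `Q_θ` found there — "a good
prime dividing `N_c(P)` is a prime at which `t_c(P)` meets the critical-value divisor
`A_c = t_c(R_{t_c})`". [cite: MochizukiGenEll2010, Thm 2.1 proof p.12] -/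
theorem exists_critValueC_near (k : ℕ) (h2 : v 2 = 1) (he : v ((2 * k + 1 : ℕ) : K) = 1) {c : K}
    (hcv : v c = 1) (hsplit : (RpolyC k c).Splits) {x r : K}
    (h : r ^ (2 * k + 1) = x * (1 - x)) (hr : v r ≤ 1) (hN : v (NvalC k c (x, r)) < 1) :
    ∃ θ : K, (RpolyC k c).eval θ = 0 ∧ v (r - θ) < 1 ∧ v (x - critXC k c θ) < 1 ∧
      v (((1 - 2 * x) + c * r ^ (k + 2)) / (r * (1 - 2 * x)) -
        ((1 - 2 * critXC k c θ) + c * θ ^ (k + 2)) / (θ * (1 - 2 * critXC k c θ))) < 1 := by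
  obtain ⟨θ, hθR, hθ, hxθ, hθ1, -, hsθ1⟩ := exists_critPointC_near v k h2 he hcv hsplit h hr hN
  obtain ⟨hr1, hs1⟩ := units_of_NvalC_lt v k h2 he hcv h hr hN
  have hx1 := map_fst_le_one v k h hr
  have hss : v ((1 - 2 * x) - (1 - 2 * critXC k c θ)) < 1 := by
    have e : (1 - 2 * x) - (1 - 2 * critXC k c θ) = -(2 * (x - critXC k c θ)) := by ring
    rw [e, Valuation.map_neg, Valuation.map_mul, h2, one_mul]; exact hxθ
  refine ⟨θ, hθR, hθ, hxθ, map_div_sub_div_ltC v ?_ ?_ ?_ ?_ ?_⟩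
  · refine v.map_add_le (map_s_le_one v k h hr) ?_
    rw [Valuation.map_mul, Valuation.map_pow, hcv, one_mul]
    exact pow_le_one' hr _
  · rw [Valuation.map_mul, hr1, hs1, one_mul]
  · rw [Valuation.map_mul, hθ1, hsθ1, one_mul]
  · have e : (1 - 2 * x) + c * r ^ (k + 2) - ((1 - 2 * critXC k c θ) + c * θ ^ (k + 2)) =
        ((1 - 2 * x) - (1 - 2 * critXC k c θ)) + c * (r ^ (k + 2) - θ ^ (k + 2)) := by ring
    rw [e]
    refine v.map_add_lt hss ?_
    rw [Valuation.map_mul, hcv, one_mul]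
    exact map_pow_sub_pow_ltC v hr hθ1.le hθ _
  · exact map_mul_sub_mul_ltC v hr hsθ1.le hθ hss

/-- **(G2) for the family, packaged for the summation**: under the hypotheses of
`exists_critValueC_near`, if a set `B ⊆ K` contains the critical value `t_c(Q_θ)` for every root `θ`
of `R_c` in `K` ("critical values ⊆ `B`"), then `t_c(P)` meets `B` at `v`:
`∃ b ∈ B, v(t_c(P) − b) < 1` — the `hconv` input of `De.good_place_dichotomy` / `De.ord_placewise`
for the member `t_c`. [cite: MochizukiGenEll2010, Thm 2.1 proof p.12] -/
theorem exists_mem_valuation_tC_sub_lt_one (k : ℕ) (h2 : v 2 = 1) (he : v ((2 * k + 1 : ℕ) : K) = 1)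
    {c : K} (hcv : v c = 1) (hsplit : (RpolyC k c).Splits) (B : Set K)
    (hcrit : ∀ θ : K, (RpolyC k c).eval θ = 0 →
      ((1 - 2 * critXC k c θ) + c * θ ^ (k + 2)) / (θ * (1 - 2 * critXC k c θ)) ∈ B)
    {x r : K} (h : r ^ (2 * k + 1) = x * (1 - x)) (hr : v r ≤ 1) (hN : v (NvalC k c (x, r)) < 1) :
    ∃ b ∈ B, v (((1 - 2 * x) + c * r ^ (k + 2)) / (r * (1 - 2 * x)) - b) < 1 := by
  obtain ⟨θ, hθR, -, -, ht⟩ := exists_critValueC_near v k h2 he hcv hsplit h hr hN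
  exact ⟨_, hcrit θ hθR, ht⟩

/-! ## Off the integral chart: a point with `v(r) > 1` carries no ramification credit -/

/-- **Non-integral points carry no credit for the family**: on `D_e`, if `v(2) = v(c) = 1` and
`v(r) > 1` then `v(N_c(P)) > 1` — the term `2c·r^{3k+3}` dominates (`v(s)² = v(β(r)) = v(r)^{2k+1}`,
`v(c·α(r)) = v(r)^{3k+3} > v(s³)`). Hence the hypothesis `v(N_c(P)) < 1` of the good-prime reduction
already forces `v(r) ≤ 1`, and the `hconv` supplier below needs no chart hypothesis.
[cite: MochizukiGenEll2010, Thm 2.1 proof p.12] -/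
theorem one_lt_map_NvalC_of_one_lt (k : ℕ) (h2 : v 2 = 1) {c : K} (hcv : v c = 1) {x r : K}
    (h : r ^ (2 * k + 1) = x * (1 - x)) (hr : 1 < v r) : 1 < v (NvalC k c (x, r)) := by
  have h4 : v (4 : K) = 1 := by
    have : (4 : K) = 2 * 2 := by norm_num
    rw [this, Valuation.map_mul, h2, one_mul]
  have hre : 1 < v r ^ (2 * k + 1) := one_lt_pow₀ hr (by omega)
  -- `v(β(r)) = v(r)^{2k+1}`
  have hβ : v (beta k r) = v r ^ (2 * k + 1) := by
    have e : beta k r = 1 - 4 * r ^ (2 * k + 1) := rfl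
    have h4r : v (4 * r ^ (2 * k + 1)) = v r ^ (2 * k + 1) := by
      rw [Valuation.map_mul, h4, one_mul, Valuation.map_pow]
    rw [e, Valuation.map_sub_eq_of_lt_right, h4r]
    rw [Valuation.map_one, h4r]; exact hre
  -- `v(s)² = v(r)^{2k+1}`
  have hs2 : v (1 - 2 * x) ^ 2 = v r ^ (2 * k + 1) := by
    rw [← Valuation.map_pow, ← beta_eq_sq_of_mem k h, hβ]
  -- `v(c·α(r)) = v(r)^{3k+3}`
  have hk1 : v ((k : K) + 1) ≤ 1 := by
    have := map_natCast_le_oneC v (k + 1)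
    push_cast at this
    exact this
  have hin : v (((k : K) + 1) - 2 * r ^ (2 * k + 1)) = v r ^ (2 * k + 1) := by
    have h2r : v (2 * r ^ (2 * k + 1)) = v r ^ (2 * k + 1) := by
      rw [Valuation.map_mul, h2, one_mul, Valuation.map_pow]
    rw [Valuation.map_sub_eq_of_lt_right, h2r]
    rw [h2r]; exact lt_of_le_of_lt hk1 hre
  have hcα : v (c * alpha k r) = v r ^ (3 * k + 3) := by
    have e : c * alpha k r = c * (r ^ (k + 2) * (((k : K) + 1) - 2 * r ^ (2 * k + 1))) := by
      simp only [alpha]; ring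
    rw [e, Valuation.map_mul, hcv, one_mul, Valuation.map_mul, Valuation.map_pow, hin, ← pow_add,
      show k + 2 + (2 * k + 1) = 3 * k + 3 by omega]
  -- `v(s³) < v(c·α(r))` by comparing squares
  have hs3 : v (-(1 - 2 * x) ^ 3) < v (c * alpha k r) := by
    rw [Valuation.map_neg, Valuation.map_pow, hcα]
    have hsq : (v (1 - 2 * x) ^ 3) ^ 2 < (v r ^ (3 * k + 3)) ^ 2 := by
      rw [← pow_mul, show 3 * 2 = 2 * 3 by norm_num, pow_mul, hs2, ← pow_mul, ← pow_mul]
      exact pow_lt_pow_right₀ hr (by omega)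
    exact lt_of_pow_lt_pow_left₀ 2 zero_le hsq
  show 1 < v (-(1 - 2 * x) ^ 3 + c * alpha k r)
  rw [v.map_add_eq_of_lt_right hs3, hcα]
  exact one_lt_pow₀ hr (by omega)

/-- **(G2) for the family with NO chart hypothesis** (the `hconv` supplier): for a valuation with
`v(2) = v(2k+1) = v(c) = 1` over which `R_c` splits, a set `B ∋ t_c(Q_θ)` for every root `θ` of `R_c`
("critical values ⊆ `B`"), and ANY point `P = (x, r) ∈ D_e(K)` with `v(N_c(P)) < 1`, the value
`t_c(P)` meets `B` at `v`: `∃ b ∈ B, v(t_c(P) − b) < 1`. (Integrality of `P` is derived: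
`one_lt_map_NvalC_of_one_lt`.) [cite: MochizukiGenEll2010, Thm 2.1 proof p.12] -/
theorem exists_mem_valuation_tC_sub_lt_one' (k : ℕ) (h2 : v 2 = 1) (he : v ((2 * k + 1 : ℕ) : K) = 1)
    {c : K} (hcv : v c = 1) (hsplit : (RpolyC k c).Splits) (B : Set K)
    (hcrit : ∀ θ : K, (RpolyC k c).eval θ = 0 →
      ((1 - 2 * critXC k c θ) + c * θ ^ (k + 2)) / (θ * (1 - 2 * critXC k c θ)) ∈ B)
    {x r : K} (h : r ^ (2 * k + 1) = x * (1 - x)) (hN : v (NvalC k c (x, r)) < 1) :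
    ∃ b ∈ B, v (((1 - 2 * x) + c * r ^ (k + 2)) / (r * (1 - 2 * x)) - b) < 1 := by
  have hr : v r ≤ 1 := by
    by_contra hr
    exact lt_irrefl _ ((one_lt_map_NvalC_of_one_lt v k h2 hcv h (not_le.mp hr)).trans hN)
  exact exists_mem_valuation_tC_sub_lt_one v k h2 he hcv hsplit B hcrit h hr hN

end Valued

end DeCrit

end Literature.NumberTheory.DiophantineGeometry.GenEll

end
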